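import Summits.CriticalPhenomena.PercolationContinuityZ3.Theorems.SahiCMTP2DensityConverse
import Mathlib.MeasureTheory.Covering.Besicovitch
import Mathlib.MeasureTheory.Covering.BesicovitchVectorSpace
import Mathlib.MeasureTheory.Function.EssSup
import Mathlib.MeasureTheory.Measure.Lebesgue.Basic

/-!
# Lower corner boxes, quasi-invariance of `λ ⊗ λ` under meet/join, essential suprema over corners (preliminaries)

Support file of the Sahi cell (`prim-sahi`, typer seat, generation 20; `--supports stmt-CriticalPhenomena-4575`).
Theorems only (no definitions, no named facts, no sorries).  Tools for `SahiAECornerEnvelope.lean` (the Borel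
everywhere-MTP₂ version of an a.e.-MTP₂, a.e.-monotone density):

* lower corner boxes `∏ᵢ (pᵢ − ε, pᵢ]` of `ℝ^ι`: lattice algebra (`inf_mem_lowerCorner`, `sup_mem_lowerCorner`),
  `volume_lowerCorner = ε^{|ι|}`, `volume_closedBall_eq_pow_mul` (`= 2^{|ι|} ε^{|ι|}` for the sup norm),
  `lowerCorner_subset_closedBall`;
* **quasi-invariance** `volume_prod_inf_mem_null` / `volume_prod_sup_mem_null`: a Lebesgue-null set of `ℝ^ι` is
  avoided by `x ∧ y` and `x ∨ y` for `λ ⊗ λ`-a.e. `(x, y)` (the meet is one of the `2^{|ι|}` coordinate gluings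
  `S.piecewise x y`, each followed by a projection of a measure-preserving shuffle of `λ ⊗ λ`,
  `measurePreserving_piecewise_pair_volume`); for FINITE product reference measures the tree has
  `SahiCMTP2.prod_map_inf_absolutelyContinuous`;
* essential suprema of `[0,∞]`-valued functions over corners: level-set characterisation and Borel measurability
  of `p ↦ ess sup_{C_ε(p)} g` (`measurable_essSup_lowerCorner`, by Fubini).

No sorries, no new axioms.
-/

noncomputable section

namespace Summit.CriticalPhenomena.PercolationContinuityZ3.Theorems.SahiAEFourFunctions

open MeasureTheory Set Filter Topology Metric
open Summit.CriticalPhenomena.PercolationContinuityZ3.Theorems.SahiCMTP2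
open scoped ENNReal NNReal

variable {ι : Type*} [Fintype ι]

/-! ### Lower corner boxes -/

section Corner

/-- Measurability of a corner box. [folklore] -/
theorem measurableSet_lowerCorner (p : ι → ℝ) (ε : ℝ) :
    MeasurableSet (Set.pi univ fun i => Ioc (p i - ε) (p i)) :=
  MeasurableSet.univ_pi fun _ => measurableSet_Ioc

omit [Fintype ι] in
/-- The meet of points of two corner boxes lies in the corner box of the meet. [folklore] -/
theorem inf_mem_lowerCorner {p q x y : ι → ℝ} {ε : ℝ} (hx : x ∈ Set.pi univ fun i => Ioc (p i - ε) (p i))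
    (hy : y ∈ Set.pi univ fun i => Ioc (q i - ε) (q i)) :
    x ⊓ y ∈ Set.pi univ fun i => Ioc ((p ⊓ q) i - ε) ((p ⊓ q) i) := by
  rw [Set.mem_univ_pi] at hx hy ⊢
  intro i
  obtain ⟨hx1, hx2⟩ := hx i
  obtain ⟨hy1, hy2⟩ := hy i
  simp only [Pi.inf_apply]
  exact ⟨lt_min (lt_of_le_of_lt (sub_le_sub_right (min_le_left _ _) _) hx1)
    (lt_of_le_of_lt (sub_le_sub_right (min_le_right _ _) _) hy1), min_le_min hx2 hy2⟩

omit [Fintype ι] in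
/-- The join of points of two corner boxes lies in the corner box of the join. [folklore] -/
theorem sup_mem_lowerCorner {p q x y : ι → ℝ} {ε : ℝ} (hx : x ∈ Set.pi univ fun i => Ioc (p i - ε) (p i))
    (hy : y ∈ Set.pi univ fun i => Ioc (q i - ε) (q i)) :
    x ⊔ y ∈ Set.pi univ fun i => Ioc ((p ⊔ q) i - ε) ((p ⊔ q) i) := by
  rw [Set.mem_univ_pi] at hx hy ⊢
  intro i
  obtain ⟨hx1, hx2⟩ := hx i
  obtain ⟨hy1, hy2⟩ := hy i
  simp only [Pi.sup_apply]
  refine ⟨?_, max_le_max hx2 hy2⟩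
  rcases le_total (p i) (q i) with h | h
  · rw [max_eq_right h]; exact lt_of_lt_of_le hy1 (le_max_right _ _)
  · rw [max_eq_left h]; exact lt_of_lt_of_le hx1 (le_max_left _ _)

omit [Fintype ι] in
/-- A corner box lies below its corner. [folklore] -/
theorem le_of_mem_lowerCorner {p x : ι → ℝ} {ε : ℝ} (hx : x ∈ Set.pi univ fun i => Ioc (p i - ε) (p i)) :
    x ≤ p := fun i => by
  rw [Set.mem_univ_pi] at hx
  exact (hx i).2

/-- A corner box lies in the sup-norm ball of the same radius. [folklore] -/
theorem lowerCorner_subset_closedBall (p : ι → ℝ) {ε : ℝ} (hε : 0 ≤ ε) :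
    (Set.pi univ fun i => Ioc (p i - ε) (p i)) ⊆ closedBall p ε := by
  intro x hx
  rw [closedBall_eq_Icc_pi _ hε]
  rw [Set.mem_univ_pi] at hx
  exact ⟨fun i => (hx i).1.le, fun i => (hx i).2.trans (by linarith)⟩

/-- Volume of a corner box. [folklore] -/
theorem volume_lowerCorner (p : ι → ℝ) (ε : ℝ) :
    volume (Set.pi univ fun i => Ioc (p i - ε) (p i)) = ENNReal.ofReal ε ^ Fintype.card ι := by
  rw [Real.volume_pi_Ioc]
  simp only [sub_sub_cancel, Finset.prod_const, Finset.card_univ]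

/-- Volume of a sup-norm ball: `2^{|ι|}` corner boxes. [folklore] -/
theorem volume_closedBall_eq_pow_mul (p : ι → ℝ) {ε : ℝ} (hε : 0 ≤ ε) :
    volume (closedBall p ε) = 2 ^ Fintype.card ι * ENNReal.ofReal ε ^ Fintype.card ι := by
  rw [Real.volume_pi_closedBall p hε, mul_pow, ENNReal.ofReal_mul (by positivity), ENNReal.ofReal_pow zero_le_two,
    ENNReal.ofReal_pow hε, ENNReal.ofReal_ofNat]

end Corner

/-! ### Quasi-invariance of `λ ⊗ λ` under the coordinatewise meet and join -/

section QuasiInvariance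

section Piecewise

variable [DecidableEq ι]

/-- Gluing two independent Lebesgue samples along `S` (and the complementary gluing) preserves `λ ⊗ λ`. [folklore] -/
theorem measurePreserving_piecewise_pair_volume (S : Finset ι) :
    MeasurePreserving (fun p : (ι → ℝ) × (ι → ℝ) => (S.piecewise p.1 p.2, S.piecewise p.2 p.1))
      ((volume : Measure (ι → ℝ)).prod volume) ((volume : Measure (ι → ℝ)).prod volume) := by
  classical
  set e := MeasurableEquiv.arrowProdEquivProdArrow ℝ ℝ ι with he_def
  have he : MeasurePreserving e (Measure.pi fun _ : ι => (volume : Measure ℝ).prod volume)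
      ((volume : Measure (ι → ℝ)).prod volume) := by
    have := measurePreserving_arrowProdEquivProdArrow ℝ ℝ ι (fun _ => volume) (fun _ => volume)
    simpa only [volume_pi] using this
  set Ψ : (ι → ℝ × ℝ) → (ι → ℝ × ℝ) := fun w i => if i ∈ S then w i else (w i).swap with hΨ
  have hΨ' : MeasurePreserving Ψ (Measure.pi fun _ : ι => (volume : Measure ℝ).prod volume)
      (Measure.pi fun _ : ι => (volume : Measure ℝ).prod volume) := by
    refine measurePreserving_pi _ _ (f := fun i (z : ℝ × ℝ) => if i ∈ S then z else z.swap) fun i => ?_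
    by_cases hi : i ∈ S
    · simp only [hi, if_true]; exact MeasurePreserving.id _
    · simp only [hi, if_false]; exact Measure.measurePreserving_swap
  have hcomp : (fun p : (ι → ℝ) × (ι → ℝ) => (S.piecewise p.1 p.2, S.piecewise p.2 p.1)) = e ∘ Ψ ∘ e.symm := by
    funext p
    ext i
    · by_cases hi : i ∈ S
      · simp [he_def, hΨ, hi, MeasurableEquiv.arrowProdEquivProdArrow, Equiv.arrowProdEquivProdArrow]
      · simp [he_def, hΨ, hi, MeasurableEquiv.arrowProdEquivProdArrow, Equiv.arrowProdEquivProdArrow]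
    · by_cases hi : i ∈ S
      · simp [he_def, hΨ, hi, MeasurableEquiv.arrowProdEquivProdArrow, Equiv.arrowProdEquivProdArrow]
      · simp [he_def, hΨ, hi, MeasurableEquiv.arrowProdEquivProdArrow, Equiv.arrowProdEquivProdArrow]
  rw [hcomp]
  exact he.comp (hΨ'.comp (he.symm _))

/-- A Lebesgue-null set is avoided by each coordinate gluing of two independent samples, almost surely. [folklore] -/
theorem volume_prod_piecewise_mem_null (S : Finset ι) {N : Set (ι → ℝ)} (hN : volume N = 0) :
    ((volume : Measure (ι → ℝ)).prod volume) {p | S.piecewise p.1 p.2 ∈ N} = 0 := by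
  set N' := toMeasurable volume N with hN'
  have hN'0 : volume N' = 0 := by rw [hN', measure_toMeasurable, hN]
  have hsub : {p : (ι → ℝ) × (ι → ℝ) | S.piecewise p.1 p.2 ∈ N} ⊆
      (fun p : (ι → ℝ) × (ι → ℝ) => (S.piecewise p.1 p.2, S.piecewise p.2 p.1)) ⁻¹' (N' ×ˢ univ) := fun p hp =>
    ⟨subset_toMeasurable _ _ hp, mem_univ _⟩
  refine measure_mono_null hsub ?_
  rw [(measurePreserving_piecewise_pair_volume S).measure_preimage
    ((measurableSet_toMeasurable _ _).prod MeasurableSet.univ).nullMeasurableSet, Measure.prod_prod, hN'0, zero_mul]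

/-- The coordinatewise meet is a coordinate gluing. [folklore] -/
theorem inf_eq_piecewise_filter (x y : ι → ℝ) :
    x ⊓ y = (Finset.univ.filter fun i => x i ≤ y i).piecewise x y := by
  funext i
  by_cases h : x i ≤ y i
  · rw [Finset.piecewise_eq_of_mem _ _ _ (by simpa using h), Pi.inf_apply, inf_eq_left.2 h]
  · rw [Finset.piecewise_eq_of_notMem _ _ _ (by simpa using h), Pi.inf_apply, inf_eq_right.2 (le_of_not_ge h)]

/-- The coordinatewise join is a coordinate gluing. [folklore] -/
theorem sup_eq_piecewise_filter (x y : ι → ℝ) :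
    x ⊔ y = (Finset.univ.filter fun i => y i ≤ x i).piecewise x y := by
  funext i
  by_cases h : y i ≤ x i
  · rw [Finset.piecewise_eq_of_mem _ _ _ (by simpa using h), Pi.sup_apply, sup_eq_left.2 h]
  · rw [Finset.piecewise_eq_of_notMem _ _ _ (by simpa using h), Pi.sup_apply, sup_eq_right.2 (le_of_not_ge h)]

end Piecewise

/-- **Quasi-invariance of `λ ⊗ λ` under the meet**: a Lebesgue-null set of `ℝ^ι` is avoided by `x ∧ y` for
`λ ⊗ λ`-almost every `(x, y)`. [folklore] -/
theorem volume_prod_inf_mem_null {N : Set (ι → ℝ)} (hN : volume N = 0) :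
    ((volume : Measure (ι → ℝ)).prod volume) {p | p.1 ⊓ p.2 ∈ N} = 0 := by
  classical
  have hsub : {p : (ι → ℝ) × (ι → ℝ) | p.1 ⊓ p.2 ∈ N} ⊆ ⋃ S : Finset ι, {p | S.piecewise p.1 p.2 ∈ N} := by
    intro p hp
    refine mem_iUnion.2 ⟨Finset.univ.filter fun i => p.1 i ≤ p.2 i, ?_⟩
    show (Finset.univ.filter fun i => p.1 i ≤ p.2 i).piecewise p.1 p.2 ∈ N
    rwa [← inf_eq_piecewise_filter]
  exact measure_mono_null hsub (measure_iUnion_null fun S => volume_prod_piecewise_mem_null S hN)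

/-- **Quasi-invariance of `λ ⊗ λ` under the join.** [folklore] -/
theorem volume_prod_sup_mem_null {N : Set (ι → ℝ)} (hN : volume N = 0) :
    ((volume : Measure (ι → ℝ)).prod volume) {p | p.1 ⊔ p.2 ∈ N} = 0 := by
  classical
  have hsub : {p : (ι → ℝ) × (ι → ℝ) | p.1 ⊔ p.2 ∈ N} ⊆ ⋃ S : Finset ι, {p | S.piecewise p.1 p.2 ∈ N} := by
    intro p hp
    refine mem_iUnion.2 ⟨Finset.univ.filter fun i => p.2 i ≤ p.1 i, ?_⟩
    show (Finset.univ.filter fun i => p.2 i ≤ p.1 i).piecewise p.1 p.2 ∈ N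
    rwa [← sup_eq_piecewise_filter]
  exact measure_mono_null hsub (measure_iUnion_null fun S => volume_prod_piecewise_mem_null S hN)

end QuasiInvariance

/-! ### Essential suprema over corner boxes -/

section EssSup

omit [Fintype ι] in
/-- Below the essential supremum every level set has positive measure. [folklore] -/
theorem measure_ne_zero_of_lt_essSup' {α : Type*} [MeasurableSpace α] {μ : Measure α} {f : α → ℝ≥0∞}
    {a : ℝ≥0∞} (ha : a < essSup f μ) : μ {x | a < f x} ≠ 0 := by
  intro h0
  have hae : ∀ᵐ x ∂μ, f x ≤ a := by
    rw [ae_iff]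
    simpa only [not_le] using h0
  exact (lt_irrefl a) (ha.trans_le (essSup_le_of_ae_le a hae))

omit [Fintype ι] in
/-- Above the essential supremum of the restriction to `C`, the level set meets `C` in a null set. [folklore] -/
theorem measure_inter_eq_zero_of_essSup_restrict_le {α : Type*} [MeasurableSpace α] {μ : Measure α} {f : α → ℝ≥0∞}
    (hf : Measurable f) {C : Set α} {c : ℝ≥0∞} (hc : essSup f (μ.restrict C) ≤ c) :
    μ ({x | c < f x} ∩ C) = 0 := by
  rw [← Measure.restrict_apply (measurableSet_lt measurable_const hf)]
  refine measure_mono_null (fun x (hx : c < f x) => ?_) (meas_essSup_lt (μ := μ.restrict C) (f := f))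
  exact lt_of_le_of_lt hc hx

omit [Fintype ι] in
/-- Conversely. [folklore] -/
theorem essSup_restrict_le_of_measure_inter_eq_zero {α : Type*} [MeasurableSpace α] {μ : Measure α} {f : α → ℝ≥0∞}
    (hf : Measurable f) {C : Set α} {c : ℝ≥0∞} (h0 : μ ({x | c < f x} ∩ C) = 0) :
    essSup f (μ.restrict C) ≤ c := by
  refine essSup_le_of_ae_le c ?_
  have h1 : (μ.restrict C) {x | c < f x} = 0 := by
    rw [Measure.restrict_apply (measurableSet_lt measurable_const hf)]; exact h0
  have h2 : ∀ᵐ x ∂μ.restrict C, ¬ c < f x := by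
    rw [ae_iff]; simpa only [not_not] using h1
  filter_upwards [h2] with x hx using not_lt.1 hx

/-- **Measurability of the corner essential supremum** `p ↦ ess sup_{C_ε(p)} g`. [folklore] -/
theorem measurable_essSup_lowerCorner {g : (ι → ℝ) → ℝ≥0∞} (hg : Measurable g) (ε : ℝ) :
    Measurable fun p : ι → ℝ => essSup g (volume.restrict (Set.pi univ fun i => Ioc (p i - ε) (p i))) := by
  refine measurable_of_Iic fun c => ?_
  have hC2 : MeasurableSet {q : (ι → ℝ) × (ι → ℝ) | q.2 ∈ Set.pi univ fun i => Ioc (q.1 i - ε) (q.1 i)} := by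
    have e : {q : (ι → ℝ) × (ι → ℝ) | q.2 ∈ Set.pi univ fun i => Ioc (q.1 i - ε) (q.1 i)} =
        ⋂ i, ({q : (ι → ℝ) × (ι → ℝ) | q.1 i - ε < q.2 i} ∩ {q | q.2 i ≤ q.1 i}) := by
      ext q
      simp only [Set.mem_setOf_eq, Set.mem_univ_pi, Set.mem_Ioc, Set.mem_iInter, Set.mem_inter_iff]
    rw [e]
    refine MeasurableSet.iInter fun i => (measurableSet_lt ?_ ?_).inter (measurableSet_le ?_ ?_)
    · exact ((measurable_pi_apply i).comp measurable_fst).sub measurable_const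
    · exact (measurable_pi_apply i).comp measurable_snd
    · exact (measurable_pi_apply i).comp measurable_snd
    · exact (measurable_pi_apply i).comp measurable_fst
  have hT : MeasurableSet {q : (ι → ℝ) × (ι → ℝ) | c < g q.2 ∧ q.2 ∈ Set.pi univ fun i => Ioc (q.1 i - ε) (q.1 i)} :=
    (measurableSet_lt measurable_const (hg.comp measurable_snd)).inter hC2
  have hm : Measurable fun p : ι → ℝ => volume (Prod.mk p ⁻¹' {q : (ι → ℝ) × (ι → ℝ) |
      c < g q.2 ∧ q.2 ∈ Set.pi univ fun i => Ioc (q.1 i - ε) (q.1 i)}) := measurable_measure_prodMk_left hT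
  have hset : (fun p : ι → ℝ => essSup g (volume.restrict (Set.pi univ fun i => Ioc (p i - ε) (p i)))) ⁻¹' Iic c =
      (fun p : ι → ℝ => volume (Prod.mk p ⁻¹' {q : (ι → ℝ) × (ι → ℝ) |
        c < g q.2 ∧ q.2 ∈ Set.pi univ fun i => Ioc (q.1 i - ε) (q.1 i)})) ⁻¹' {0} := by
    ext p
    simp only [mem_preimage, mem_Iic, mem_singleton_iff]
    have e : Prod.mk p ⁻¹' {q : (ι → ℝ) × (ι → ℝ) | c < g q.2 ∧ q.2 ∈ Set.pi univ fun i => Ioc (q.1 i - ε) (q.1 i)} =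
        {x | c < g x} ∩ Set.pi univ fun i => Ioc (p i - ε) (p i) := rfl
    rw [e]
    exact ⟨measure_inter_eq_zero_of_essSup_restrict_le hg, essSup_restrict_le_of_measure_inter_eq_zero hg⟩
  rw [hset]
  exact hm (measurableSet_singleton 0)

end EssSup

end Summit.CriticalPhenomena.PercolationContinuityZ3.Theorems.SahiAEFourFunctions
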